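import Literature.NumberTheory.LFunctions.MertensCertificate
import Summits.RiemannHypothesis.RiemannHypothesis.Theorems.Splittings.NbHalfDoubling
import HarnessLib

/-!
# NB Burnol floor over the 2000 Odlyzko–te Riele zeros: `0.214 → 0.28467` (SPLIT-nb-neg gen 8, §14)

Cell rh-split, seat rh-split-nb-neg g8 (brief sha16 f79c5f09d8bcb036), card
`run/shared/lean/pub/rh-split/cards/SPLIT-nb-neg.md` §14.  RH-free kernel theorems, ZERO `def`s.

The tree's Burnol floor for the Nyman–Beurling rate conjuncts (`lt_const_of_eventually_nbRateBound`,
`NbHalfDoubling.lt_const_of_frequently_nbRateBound`: every (frequently) admissible constant `C` in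
`d_N² ≤ C/log N` exceeds `0.214`) uses the 29 zero pairs of `RiemannHypothesisUpTo101.lean`
(`exists_finset_zeros_sum_ge`, `Σ m²/|ρ|² ≥ 0.03407`).  The tree ALSO holds, since the certified
Odlyzko–te Riele recomputation (`Literature/NumberTheory/LFunctions/MertensCertificate.lean`), brackets of
width `2⁻²⁴⁰` for the first 2000 zeros `½ + iγ_j` (`γ₂₀₀₀ ≈ 2515.29`), each certified to contain a zero of
`ζ` ON the critical line by a twisted sign test (`ZetaNumerics.Mertens.checkChunk_sound`, twenty compiled
block checks `checkChunk_00 … checkChunk_19`).  This file feeds those 2000 pairs into Burnol's finite-family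
bound:

1. `exists_finset_zeros_sum_ge_of_checks` — from the twenty block checks, a finite set `G` of critical zeros
   (the 2000 bracketed zeros and their conjugates) with `Σ_{ρ∈G} m_ρ²/|ρ|² ≥ 2 Σ_{j<2000} 1/(¼ + t₂ⱼ²)`,
   `t₂ⱼ = (a_j+1)2⁻²⁴⁰` the upper bracket ends;
2. `sum_inv_ge_of_int_le` — soundness of the exact integer evaluation
   `L ≤ Σ_j ⌊2⁵⁴⁰/(2⁴⁷⁸+(a_j+1)²)⌋ ⟹ L·2⁻⁶⁰ ≤ Σ_j 1/(¼+t₂ⱼ²)` (the comparison itself, with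
   `L = 26117558415922292`, `L·2⁻⁶⁰ = 0.0226533708…`, is ONE compiled integer check, kept OUT of this file:
   `NbMertensZerosFloorEval.lean`);
3. `four_pi_mul_sum_le_of_frequently_nbRateBound`, `lt_const_of_frequently_nbRateBound_of_checks` — every
   frequently admissible constant satisfies `C ≥ 4π Σ_j 1/(¼+t₂ⱼ²)`, numerically `C > 0.28467`
   (`= 98.08 %` of the conjectured BDBLS constant `2π(2+γ−log 4π) = 0.29023…`; the 29 pairs gave `73.7 %`);
4. `not_nb_rateTail_of_lt_of_checks` (`TailRate(C,H)` is FALSE for every `C < 0.28467` and every `H`),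
   `not_nb_halfDoublingTail_of_certificate_of_checks` (ONE level `N₀ ≥ max(H,2)` with
   `I(N₀,a₀)·log N₀ ≤ c < 0.28467` refutes `TailDoubling(½,H)`), `nb_levelFloor_of_halfDoublingTail_of_checks`
   (`TailDoubling(½,H) ⟹ 0.28467/log N ≤ I(N,a)` for all `N ≥ max(H,2)`, all `a`).

All theorems here take the block checks `(hCh : ∀ k < 20, checkChunk k = true)` and, where numeric, the
integer comparison `(hS : L ≤ Σ …)` as HYPOTHESES, so this file is on the standard axioms; the assembled
unconditional corollaries (closure `+ Lean.ofReduceBool` via the tree's `checkChunk_00…19` and one more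
`native_decide`) are in the sibling `NbMertensZerosFloorEval.lean`, exactly as the tree assembles
`OdlyzkoTeRiele1985_numerics_holds` (`RHWave0MertensProofs.lean`).

Splitting-matrix reading (card §14): the boundary between the FALSE rate tails (`C` small) and the
RH-or-stronger rate tails (`rh_of_nb_rateTail`, any `C`) moves from `0.214` to `0.28467` in the kernel
(`98 %` of the conjectured `0.29023`); the `θ = ½` doubling tail's one-level certificate threshold moves
from `c < 0.214` — met by NO level (on the scale `I·log N = 2π·d_N²·log N` the hub's certified table
`rh-li/data/nb_R_dN2_allN10000.tsv` has minimum `2π·0.044188 = 0.2776` at `N = 695`) — to `c < 0.28467`,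
met by 3472 levels `N₀ ∈ [228, 10⁴]` of that table (first `N₀ = 228`, `2π·0.0453016 = 0.28464`; best
`N₀ = 695`, margin `7.0·10⁻³`; `N₀ = 10⁴`, margin `1.1·10⁻³`); so the remaining blocker for a kernel
`¬TailDoubling(½, H)`, `H ≤ 10⁴`, is a certified NB-distance UPPER bound at ONE level (`T10`, not ported),
no longer the zero supply.  HONEST LABEL: «SPLITTING SEARCH over kernel-typed
RH-EQUIVALENCES; a splitting A ∧ B ⟹ RH is CONDITIONAL bookkeeping unless A and B are both proved; nothing
here bears on the truth of RH.»

References: [Burnol2002] J.-F. Burnol, *A lower bound in an approximation problem involving the zeros of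
the Riemann zeta function*, Adv. Math. 170 (2002) 56–70, Thm. 1.3; [BDBLS2000] Báez-Duarte, Balazard,
Landreau, Saias, *Notes sur la fonction ζ de Riemann 3*, Adv. Math. 149 (2000) 130–144 (conjecture
`d_N² ∼ (2+γ−log 4π)/log N`); [OdlyzkoTeRiele1985] §4.2 p. 151 (the 2000 zeros).
-/

set_option linter.dupNamespace false

noncomputable section

open Complex MeasureTheory Set Filter Topology
open scoped Real ENNReal ComplexConjugate

namespace Summit.RiemannHypothesis.RiemannHypothesis.Theorems.Splittings.NbMertensZerosFloor

open Summit.RiemannHypothesis.RiemannHypothesis.Theorems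
open Summit.RiemannHypothesis.RiemannHypothesis.Theorems.Splittings.NbHalfDoubling
open Literature.NumberTheory.LFunctions Literature.Barriers.RiemannHypothesis
open Literature.NumberTheory.LFunctions.ZetaNumerics.Mertens

/-! ## 1. The 2000 bracketed zeros on the critical line -/

/-- Per-zero content of the twenty block checks: bracket ordering, and a zero of `ζ` with ordinate in
`[a_j 2⁻²⁴⁰, (a_j+1) 2⁻²⁴⁰]` for each `j < 2000` (the first half of `checkChunk_sound`, re-indexed as in
the proof of `numerics_of_checks`). [cite: OdlyzkoTeRiele1985, §4.2 p. 151] -/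
theorem zero_in_bracket_of_checks (hCh : ∀ k < NCHUNK, checkChunk k = true) {j : ℕ} (hj : j < NZ) :
    orderOk j = true ∧ ∃ γ ∈ Set.Icc (t₁ j) (t₂ j), riemannZeta (1 / 2 + γ * I) = 0 := by
  have hNZ : NZ = NCHUNK * CHUNK := by unfold NZ NCHUNK CHUNK; norm_num
  have hk : j / CHUNK < NCHUNK := by
    rw [hNZ] at hj; exact Nat.div_lt_of_lt_mul (by rwa [mul_comm] at hj)
  have hi : j % CHUNK < CHUNK := Nat.mod_lt _ (by unfold CHUNK; norm_num)
  have := (checkChunk_sound (hCh _ hk)).1 (j % CHUNK) hi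
  rwa [Nat.div_add_mod'] at this

/-- Bracket geometry certified by the order checks: `2 ≤ t₁ j < t₂ j` for `j < 2000`, and the brackets
are pairwise separated (`t₂ j < t₁ j'` for `j < j' < 2000`). [folklore] -/
theorem brackets_separated_of_checks (hCh : ∀ k < NCHUNK, checkChunk k = true) :
    (∀ j < NZ, 2 ≤ t₁ j ∧ t₁ j < t₂ j) ∧ ∀ j j', j < j' → j' < NZ → t₂ j < t₁ j' := by
  have hord : ∀ j < NZ, 2 ≤ t₁ j ∧ (j + 1 < NZ → t₂ j < t₁ (j + 1)) := by
    intro j hj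
    obtain ⟨h1, -, h3⟩ := orderOk_sound (zero_in_bracket_of_checks hCh hj).1
    have h2p : (0 : ℝ) < 2 ^ 240 := by positivity
    refine ⟨?_, fun hj1 ↦ ?_⟩
    · unfold t₁; rw [le_div_iff₀ h2p]; exact_mod_cast h1
    · unfold t₁ t₂; rw [div_lt_div_iff_of_pos_right h2p]; exact_mod_cast h3 hj1
  have ht12 : ∀ j, t₁ j < t₂ j := fun j ↦ by
    unfold t₁ t₂; gcongr; linarith
  refine ⟨fun j hj ↦ ⟨(hord j hj).1, ht12 j⟩, ?_⟩
  intro j j' hjj' hj'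
  induction j' with
  | zero => exact absurd hjj' (Nat.not_lt_zero _)
  | succ j' ih =>
    rcases Nat.lt_succ_iff_lt_or_eq.1 hjj' with hlt | heq
    · have := ih hlt (by omega)
      have h2 := (hord j' (by omega)).2 hj'
      linarith [ht12 j']
    · subst heq; exact (hord j (by omega)).2 hj'

/-- **The 2000 certified zero pairs.** If the twenty block checks pass, there is a finite set `G` of zeros
of `ζ` on the critical line (the 2000 bracketed zeros `½ + iγ_j`, `γ₁ = 14.13…`, …, `γ₂₀₀₀ = 2515.28…`,
and their conjugates) with `Σ_{ρ∈G} m_ρ²/|ρ|² ≥ 2 Σ_{j<2000} 1/(¼ + t₂ⱼ²)` (`|ρ_j|² = ¼ + γ_j² ≤ ¼ + t₂ⱼ²`,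
`m_ρ ≥ 1`).  The full sum over all zeros is `2 + γ − log 4π = 0.046191…` under RH.
[cite: OdlyzkoTeRiele1985, §4.2 p. 151] [cite: Burnol2002, Thm. 1.3] -/
theorem exists_finset_zeros_sum_ge_of_checks (hCh : ∀ k < NCHUNK, checkChunk k = true) :
    ∃ G : Finset ℂ, (∀ ρ ∈ G, riemannZeta ρ = 0 ∧ ρ.re = 1 / 2) ∧
      2 * ∑ j ∈ Finset.range NZ, 1 / (1 / 4 + t₂ j ^ 2) ≤
        ∑ ρ ∈ G, (riemannZetaZeroOrder ρ : ℝ) ^ 2 / ‖ρ‖ ^ 2 := by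
  classical
  obtain ⟨hgeo, hsep⟩ := brackets_separated_of_checks hCh
  have hfact : ∀ j < NZ, ∃ γ ∈ Set.Icc (t₁ j) (t₂ j), riemannZeta (1 / 2 + γ * I) = 0 :=
    fun j hj ↦ (zero_in_bracket_of_checks hCh hj).2
  -- the ordinates
  set γ : ℕ → ℝ := fun j ↦ if h : j < NZ then (hfact j h).choose else 0 with hγdef
  have hγ : ∀ j < NZ, γ j ∈ Set.Icc (t₁ j) (t₂ j) ∧ riemannZeta (1 / 2 + γ j * I) = 0 := by
    intro j hj
    have := (hfact j hj).choose_spec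
    simp only [hγdef, dif_pos hj]
    exact this
  have hγinj : Set.InjOn γ (Finset.range NZ : Set ℕ) := by
    intro j hj j' hj' h
    simp only [Finset.coe_range, Set.mem_Iio] at hj hj'
    by_contra hne
    rcases lt_or_gt_of_ne hne with hlt | hlt
    · have := hsep j j' hlt hj'
      linarith [(hγ j hj).1.2, (hγ j' hj').1.1]
    · have := hsep j' j hlt hj
      linarith [(hγ j' hj').1.2, (hγ j hj).1.1]
  -- the zeros `ρ_j = 1/2 + iγ_j`
  set ρ : ℕ → ℂ := fun j ↦ 1 / 2 + γ j * I with hρdef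
  have hρim : ∀ j, (ρ j).im = γ j := fun j ↦ by simp [hρdef]
  have hρre : ∀ j, (ρ j).re = 1 / 2 := fun j ↦ by simp [hρdef]
  have hinj : Set.InjOn ρ (Finset.range NZ : Set ℕ) := by
    intro j hj j' hj' h
    have him : γ j = γ j' := by rw [← hρim j, ← hρim j', h]
    exact hγinj hj hj' him
  set F : Finset ℂ := (Finset.range NZ).image ρ with hFdef
  have hF : ∀ z ∈ F, riemannZeta z = 0 ∧ z.re = 1 / 2 ∧ 0 < z.im := by
    intro z hz
    rw [hFdef, Finset.mem_image] at hz
    obtain ⟨j, hj, rfl⟩ := hz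
    rw [Finset.mem_range] at hj
    refine ⟨(hγ j hj).2, hρre j, ?_⟩
    rw [hρim]
    linarith [(hgeo j hj).1, (hγ j hj).1.1]
  have hFsum : ∑ j ∈ Finset.range NZ, 1 / (1 / 4 + t₂ j ^ 2) ≤ ∑ z ∈ F, 1 / ‖z‖ ^ 2 := by
    rw [hFdef, Finset.sum_image hinj]
    refine Finset.sum_le_sum fun j hj ↦ ?_
    rw [Finset.mem_range] at hj
    have h0 : 0 ≤ γ j := le_trans (by norm_num) ((hgeo j hj).1.trans (hγ j hj).1.1)
    have hle : γ j ≤ t₂ j := (hγ j hj).1.2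
    have hn : ‖ρ j‖ ^ 2 = 1 / 4 + γ j ^ 2 := by
      simp only [hρdef]; exact norm_sq_one_half_add (γ j)
    rw [hn]
    exact one_div_le_one_div_of_le (by positivity) (by nlinarith)
  -- add the conjugate zeros
  have hdisj : Disjoint F (F.image conj) := by
    rw [Finset.disjoint_left]
    intro z hz hz'
    obtain ⟨z₀, hz₀, rfl⟩ := Finset.mem_image.1 hz'
    have h1 := (hF _ hz).2.2
    have h2 := (hF _ hz₀).2.2
    rw [Complex.conj_im] at h1
    linarith
  refine ⟨F ∪ F.image conj, fun z hz ↦ ?_, ?_⟩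
  · rcases Finset.mem_union.1 hz with h | h
    · exact ⟨(hF z h).1, (hF z h).2.1⟩
    · obtain ⟨z₀, hz₀, rfl⟩ := Finset.mem_image.1 h
      refine ⟨?_, by rw [Complex.conj_re]; exact (hF z₀ hz₀).2.1⟩
      rw [riemannZeta_conj, (hF z₀ hz₀).1, map_zero]
  · -- every listed point is a zero `≠ 1`, so `m_ρ ≥ 1` and `m_ρ²/|ρ|² ≥ 1/|ρ|²`
    have hm : ∀ z : ℂ, riemannZeta z = 0 → z.re = 1 / 2 →
        1 / ‖z‖ ^ 2 ≤ (riemannZetaZeroOrder z : ℝ) ^ 2 / ‖z‖ ^ 2 := by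
      intro z hz hre
      have hne : z ≠ 1 := fun h ↦ by norm_num [h] at hre
      have h1 : (1 : ℤ) ≤ riemannZetaZeroOrder z := (riemannZetaZeroOrder_pos_iff hne).2 hz
      have h1' : (1 : ℝ) ≤ (riemannZetaZeroOrder z : ℝ) := by exact_mod_cast h1
      exact div_le_div_of_nonneg_right (one_le_pow₀ h1') (sq_nonneg _)
    have hsumG : ∑ z ∈ F ∪ F.image conj, 1 / ‖z‖ ^ 2 = 2 * ∑ z ∈ F, 1 / ‖z‖ ^ 2 := by
      rw [Finset.sum_union hdisj, Finset.sum_image fun x _ y _ h ↦ (starRingEnd ℂ).injective h]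
      simp only [Complex.norm_conj]
      ring
    calc 2 * ∑ j ∈ Finset.range NZ, 1 / (1 / 4 + t₂ j ^ 2) ≤ 2 * ∑ z ∈ F, 1 / ‖z‖ ^ 2 := by
          linarith
      _ = ∑ z ∈ F ∪ F.image conj, 1 / ‖z‖ ^ 2 := hsumG.symm
      _ ≤ _ := Finset.sum_le_sum fun z hz ↦ by
          rcases Finset.mem_union.1 hz with h | h
          · exact hm z (hF z h).1 (hF z h).2.1
          · obtain ⟨z₀, hz₀, rfl⟩ := Finset.mem_image.1 h
            refine hm _ ?_ (by rw [Complex.conj_re]; exact (hF z₀ hz₀).2.1)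
            rw [riemannZeta_conj, (hF z₀ hz₀).1, map_zero]

/-! ## 2. Soundness of the exact integer evaluation of `Σ_j 1/(¼ + t₂ⱼ²)` -/

set_option exponentiation.threshold 1024 in
/-- **One term.** The exact integer `⌊2⁵⁴⁰/(2⁴⁷⁸ + (a+1)²)⌋` is at most `2⁶⁰/(¼ + ((a+1)/2²⁴⁰)²)`.
(Hypothesis-free; the big powers are never evaluated — only `Int.ediv_mul_le` and exponent bookkeeping.)
[folklore] -/
theorem floorTerm_le (a : ℤ) :
    (((2 : ℤ) ^ 540 / (2 ^ 478 + (a + 1) ^ 2) : ℤ) : ℝ) ≤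
      2 ^ 60 * (1 / (1 / 4 + (((a : ℝ) + 1) / 2 ^ 240) ^ 2)) := by
  have hdpos : (0 : ℤ) < 2 ^ 478 + (a + 1) ^ 2 :=
    add_pos_of_pos_of_nonneg (pow_pos two_pos _) (sq_nonneg _)
  have h1 : ((2 : ℤ) ^ 540 / (2 ^ 478 + (a + 1) ^ 2)) * (2 ^ 478 + (a + 1) ^ 2) ≤ 2 ^ 540 :=
    Int.ediv_mul_le _ hdpos.ne'
  have h1' : (((2 : ℤ) ^ 540 / (2 ^ 478 + (a + 1) ^ 2) : ℤ) : ℝ) *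
      ((2 : ℝ) ^ 478 + ((a : ℝ) + 1) ^ 2) ≤ (2 : ℝ) ^ 540 := by
    exact_mod_cast h1
  clear h1 hdpos
  have hdR : (0 : ℝ) < (2 : ℝ) ^ 478 + ((a : ℝ) + 1) ^ 2 :=
    add_pos_of_pos_of_nonneg (pow_pos two_pos _) (sq_nonneg _)
  have hq : (2 : ℝ) ^ 60 * (1 / (1 / 4 + (((a : ℝ) + 1) / 2 ^ 240) ^ 2)) =
      (2 : ℝ) ^ 540 / ((2 : ℝ) ^ 478 + ((a : ℝ) + 1) ^ 2) := by
    rw [div_pow, eq_div_iff hdR.ne']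
    have h4 : (1 : ℝ) / 4 + ((a : ℝ) + 1) ^ 2 / (2 ^ 240) ^ 2 =
        ((2 : ℝ) ^ 478 + ((a : ℝ) + 1) ^ 2) / 2 ^ 480 := by ring
    rw [h4, one_div_div, mul_div_assoc', div_mul_cancel₀ _ hdR.ne']
    ring
  rw [hq, le_div_iff₀ hdR]
  exact h1'

/-- **Integer evaluation, soundness.** An integer `L` below `Σ_{j<2000} ⌊2⁵⁴⁰/(2⁴⁷⁸ + (a_j+1)²)⌋` gives
`L·2⁻⁶⁰ ≤ Σ_{j<2000} 1/(¼ + t₂ⱼ²)` (`t₂ⱼ = (a_j+1)/2²⁴⁰`). The comparison `L ≤ Σ …` itself is ONE exact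
integer computation, taken as a hypothesis here. [folklore] -/
theorem sum_inv_ge_of_int_le {L : ℤ}
    (hL : L ≤ ∑ j ∈ Finset.range NZ, (2 : ℤ) ^ 540 / (2 ^ 478 + (ordinate j + 1) ^ 2)) :
    (L : ℝ) / 2 ^ 60 ≤ ∑ j ∈ Finset.range NZ, 1 / (1 / 4 + t₂ j ^ 2) := by
  have hL' : (L : ℝ) ≤ ∑ j ∈ Finset.range NZ, (((2 : ℤ) ^ 540 / (2 ^ 478 + (ordinate j + 1) ^ 2) : ℤ) : ℝ) := by
    have := (Int.cast_le (R := ℝ)).2 hL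
    rwa [Int.cast_sum] at this
  clear hL
  have h60 : (0 : ℝ) < 2 ^ 60 := pow_pos two_pos _
  have hsum : ∑ j ∈ Finset.range NZ, (((2 : ℤ) ^ 540 / (2 ^ 478 + (ordinate j + 1) ^ 2) : ℤ) : ℝ) ≤
      ∑ j ∈ Finset.range NZ, 2 ^ 60 * (1 / (1 / 4 + t₂ j ^ 2)) :=
    Finset.sum_le_sum fun j _ ↦ by unfold t₂; exact floorTerm_le (ordinate j)
  calc (L : ℝ) / 2 ^ 60
      ≤ (∑ j ∈ Finset.range NZ, 2 ^ 60 * (1 / (1 / 4 + t₂ j ^ 2))) / 2 ^ 60 :=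
        div_le_div_of_nonneg_right (hL'.trans hsum) h60.le
    _ = ∑ j ∈ Finset.range NZ, 1 / (1 / 4 + t₂ j ^ 2) := by
        rw [← Finset.mul_sum, mul_div_cancel_left₀ _ h60.ne']

/-- The certified value: `26117558415922292 · 2⁻⁶⁰ = 0.02265337085964…  ≤ Σ_{j<2000} 1/(¼ + t₂ⱼ²)`, given
the integer comparison. [folklore] -/
theorem sum_inv_ge_of_check
    (hS : (26117558415922292 : ℤ) ≤ ∑ j ∈ Finset.range NZ, (2 : ℤ) ^ 540 / (2 ^ 478 + (ordinate j + 1) ^ 2)) :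
    (26117558415922292 : ℝ) / 2 ^ 60 ≤ ∑ j ∈ Finset.range NZ, 1 / (1 / 4 + t₂ j ^ 2) := by
  simpa only [Int.cast_ofNat] using sum_inv_ge_of_int_le hS

/-! ## 3. Burnol's floor over the 2000 pairs -/

/-- **Finite-family Burnol bound over the 2000 pairs (frequently form).** If `C` is frequently admissible
(`∃ᶠ N, ∃ a, ∫⁻ |1−ζA|²/(¼+t²) ≤ C/log N`), then `C ≥ 2π · 2 Σ_{j<2000} 1/(¼ + t₂ⱼ²)`.
[cite: Burnol2002, Thm. 1.3 and Thm. 5.4] [cite: OdlyzkoTeRiele1985, §4.2 p. 151] -/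
theorem four_pi_mul_sum_le_of_frequently_nbRateBound (hCh : ∀ k < NCHUNK, checkChunk k = true) {C : ℝ}
    (hC : ∃ᶠ N : ℕ in atTop, ∃ a : Fin N → ℂ, ∫⁻ t : ℝ, ENNReal.ofReal (‖1 - riemannZeta (1 / 2 + t * Complex.I) *
        ∑ n : Fin N, a n * ((n : ℂ) + 1) ^ (-(1 / 2 + t * Complex.I))‖ ^ 2 / (1 / 4 + t ^ 2)) ≤
      ENNReal.ofReal (C / Real.log N)) :
    2 * π * (2 * ∑ j ∈ Finset.range NZ, 1 / (1 / 4 + t₂ j ^ 2)) ≤ C := by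
  obtain ⟨G, hG, hsum⟩ := exists_finset_zeros_sum_ge_of_checks hCh
  have h := two_pi_mul_sum_multSq_le_of_frequently_nbRateBound hC G hG
  have h2 : 2 * π * (2 * ∑ j ∈ Finset.range NZ, 1 / (1 / 4 + t₂ j ^ 2)) ≤
      2 * π * ∑ ρ ∈ G, (riemannZetaZeroOrder ρ : ℝ) ^ 2 / ‖ρ‖ ^ 2 :=
    mul_le_mul_of_nonneg_left hsum (by positivity)
  linarith

set_option exponentiation.threshold 1024 in
/-- **Every frequently admissible constant exceeds `0.28467`** (`= 98.08 %` of the conjectured BDBLS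
constant `2π(2+γ−log 4π) = 0.29023…`; the tree's 29 pairs give `0.214 = 73.7 %`): the block checks plus the
integer comparison `26117558415922292 ≤ Σ_j ⌊2⁵⁴⁰/(2⁴⁷⁸+(a_j+1)²)⌋` (`L·2⁻⁶⁰ = 0.02265337…`) give
`C ≥ 4π · 0.02265337 > 0.28467`. [cite: Burnol2002, Thm. 1.3] [cite: BDBLS2000, conjecture] -/
theorem lt_const_of_frequently_nbRateBound_of_checks (hCh : ∀ k < NCHUNK, checkChunk k = true)
    (hS : (26117558415922292 : ℤ) ≤ ∑ j ∈ Finset.range NZ, (2 : ℤ) ^ 540 / (2 ^ 478 + (ordinate j + 1) ^ 2))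
    {C : ℝ}
    (hC : ∃ᶠ N : ℕ in atTop, ∃ a : Fin N → ℂ, ∫⁻ t : ℝ, ENNReal.ofReal (‖1 - riemannZeta (1 / 2 + t * Complex.I) *
        ∑ n : Fin N, a n * ((n : ℂ) + 1) ^ (-(1 / 2 + t * Complex.I))‖ ^ 2 / (1 / 4 + t ^ 2)) ≤
      ENNReal.ofReal (C / Real.log N)) :
    (28467 : ℝ) / 100000 < C := by
  have h1 := four_pi_mul_sum_le_of_frequently_nbRateBound hCh hC
  have h2 := sum_inv_ge_of_check hS
  clear hS hCh hC
  have h3 := mul_le_mul_of_nonneg_left h2 Real.pi_pos.le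
  linarith [Real.pi_gt_d6]

/-- **Eventually form** (the `∀ N ≥ H` rate conjuncts are eventually, hence frequently, admissible).
[cite: Burnol2002, Thm. 1.3] -/
theorem lt_const_of_eventually_nbRateBound_of_checks (hCh : ∀ k < NCHUNK, checkChunk k = true)
    (hS : (26117558415922292 : ℤ) ≤ ∑ j ∈ Finset.range NZ, (2 : ℤ) ^ 540 / (2 ^ 478 + (ordinate j + 1) ^ 2))
    {C : ℝ}
    (hC : ∀ᶠ N : ℕ in atTop, ∃ a : Fin N → ℂ, ∫⁻ t : ℝ, ENNReal.ofReal (‖1 - riemannZeta (1 / 2 + t * Complex.I) *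
        ∑ n : Fin N, a n * ((n : ℂ) + 1) ^ (-(1 / 2 + t * Complex.I))‖ ^ 2 / (1 / 4 + t ^ 2)) ≤
      ENNReal.ofReal (C / Real.log N)) :
    (28467 : ℝ) / 100000 < C :=
  lt_const_of_frequently_nbRateBound_of_checks hCh hS hC.frequently

/-! ## 4. Consequences for the splitting conjuncts -/

/-- **The rate tail `TailRate(C,H)` is FALSE for every `C < 0.28467` and every `H`** (tree:
`not_nb_rateTail_of_le`, `C ≤ 0.214`). For `C > 0.29023` the same tail is RH-implied only conjecturally
(BDBLS) and implies RH on its own (`rh_of_nb_rateTail`, any `C`): the splitting-matrix boundary between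
«false» and «RH-or-stronger» now sits at `0.28467`, `98 %` of the conjectured constant.
[cite: Burnol2002, Thm. 1.3] [cite: BDBLS2000, conjecture] -/
theorem not_nb_rateTail_of_lt_of_checks (hCh : ∀ k < NCHUNK, checkChunk k = true)
    (hS : (26117558415922292 : ℤ) ≤ ∑ j ∈ Finset.range NZ, (2 : ℤ) ^ 540 / (2 ^ 478 + (ordinate j + 1) ^ 2))
    {C : ℝ} (hC : C < 28467 / 100000) (H : ℕ) :
    ¬ ∀ N : ℕ, H ≤ N → ∃ a : Fin N → ℂ,
      ∫⁻ t : ℝ, ENNReal.ofReal (‖1 - riemannZeta (1 / 2 + t * Complex.I) *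
        ∑ n : Fin N, a n * ((n : ℂ) + 1) ^ (-(1 / 2 + t * Complex.I))‖ ^ 2 / (1 / 4 + t ^ 2)) ≤
      ENNReal.ofReal (C / Real.log N) := by
  intro h
  have hev : ∀ᶠ N : ℕ in atTop, ∃ a : Fin N → ℂ,
      ∫⁻ t : ℝ, ENNReal.ofReal (‖1 - riemannZeta (1 / 2 + t * Complex.I) *
        ∑ n : Fin N, a n * ((n : ℂ) + 1) ^ (-(1 / 2 + t * Complex.I))‖ ^ 2 / (1 / 4 + t ^ 2)) ≤
      ENNReal.ofReal (C / Real.log N) := eventually_atTop.2 ⟨H, fun N hN ↦ h N hN⟩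
  exact absurd (lt_const_of_eventually_nbRateBound_of_checks hCh hS hev) (not_lt.2 hC.le)

/-- **`TailDoubling(½, H)` is refuted by ONE sub-`0.28467` certificate** (tree:
`not_nb_halfDoublingTail_of_certificate`, `c < 0.214`, a threshold NO level meets: on the scale
`c = I·log N = 2π·d_N²·log N` the certified minimum over `N ≤ 10⁴` is `2π·0.044188 = 0.2776` at `N = 695`).
With the 2000 pairs: if some level `N₀ ≥ max(H,2)` carries a Dirichlet polynomial with
`∫⁻ |1−ζA|²/(¼+t²) ≤ c/log N₀`, `c < 0.28467`, then `∀ N ≥ H, D(N²) ≤ D(N)/2` is false — and the certified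
table meets `2π·d_N²·log N < 0.28467` at 3472 levels `N ∈ [228, 10⁴]` (best margin `7.0·10⁻³` at `N = 695`),
so what is missing for a kernel `¬TailDoubling(½, H)`, `H ≤ 10⁴`, is only a certified UPPER bound for
`I(N₀, a₀)` at one such level.
[cite: Burnol2002, Thm. 1.3] [cite: BDBLS2000, conjecture] -/
theorem not_nb_halfDoublingTail_of_certificate_of_checks (hCh : ∀ k < NCHUNK, checkChunk k = true)
    (hS : (26117558415922292 : ℤ) ≤ ∑ j ∈ Finset.range NZ, (2 : ℤ) ^ 540 / (2 ^ 478 + (ordinate j + 1) ^ 2))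
    {H N₀ : ℕ} (hH : H ≤ N₀) (h2 : 2 ≤ N₀) {c : ℝ} (hc : c < 28467 / 100000) (a₀ : Fin N₀ → ℂ)
    (hw : ∫⁻ t : ℝ, ENNReal.ofReal (‖1 - riemannZeta (1 / 2 + t * Complex.I) *
        ∑ n : Fin N₀, a₀ n * ((n : ℂ) + 1) ^ (-(1 / 2 + t * Complex.I))‖ ^ 2 / (1 / 4 + t ^ 2)) ≤
      ENNReal.ofReal (c / Real.log N₀)) :
    ¬ ∀ N : ℕ, H ≤ N →
      (⨅ a : Fin (N ^ 2) → ℂ, ∫ t : ℝ, ‖1 - riemannZeta (1 / 2 + t * I) *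
        ∑ n : Fin (N ^ 2), a n * ((n : ℂ) + 1) ^ (-(1 / 2 + t * I))‖ ^ 2 / (1 / 4 + t ^ 2)) ≤
      1 / 2 * (⨅ a : Fin N → ℂ, ∫ t : ℝ, ‖1 - riemannZeta (1 / 2 + t * I) *
        ∑ n : Fin N, a n * ((n : ℂ) + 1) ^ (-(1 / 2 + t * I))‖ ^ 2 / (1 / 4 + t ^ 2)) := by
  intro h
  have hfreq := frequently_rateBound_of_halfDoublingTail hH h2 h a₀ hw
    (c' := (c + 28467 / 100000) / 2) (by clear hS hCh hw h; linarith)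
  have := lt_const_of_frequently_nbRateBound_of_checks hCh hS hfreq
  clear hS hCh hw h hfreq
  linarith

/-- **Contrapositive: `TailDoubling(½, H)` predicts the per-level floor `0.28467/log N`.** If
`D(N²) ≤ D(N)/2` for all `N ≥ H`, then EVERY Dirichlet polynomial of EVERY length `N ≥ max(H,2)` has
`0.28467/log N ≤ ∫⁻ |1−ζA|²/(¼+t²)` (tree: `0.214/log N`). [cite: Burnol2002, Thm. 1.3] -/
theorem nb_levelFloor_of_halfDoublingTail_of_checks (hCh : ∀ k < NCHUNK, checkChunk k = true)
    (hS : (26117558415922292 : ℤ) ≤ ∑ j ∈ Finset.range NZ, (2 : ℤ) ^ 540 / (2 ^ 478 + (ordinate j + 1) ^ 2))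
    {H : ℕ}
    (h : ∀ N : ℕ, H ≤ N →
      (⨅ a : Fin (N ^ 2) → ℂ, ∫ t : ℝ, ‖1 - riemannZeta (1 / 2 + t * I) *
        ∑ n : Fin (N ^ 2), a n * ((n : ℂ) + 1) ^ (-(1 / 2 + t * I))‖ ^ 2 / (1 / 4 + t ^ 2)) ≤
      1 / 2 * (⨅ a : Fin N → ℂ, ∫ t : ℝ, ‖1 - riemannZeta (1 / 2 + t * I) *
        ∑ n : Fin N, a n * ((n : ℂ) + 1) ^ (-(1 / 2 + t * I))‖ ^ 2 / (1 / 4 + t ^ 2)))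
    {N : ℕ} (hH : H ≤ N) (h2 : 2 ≤ N) (a : Fin N → ℂ) :
    ENNReal.ofReal (28467 / 100000 / Real.log N) ≤
      ∫⁻ t : ℝ, ENNReal.ofReal (‖1 - riemannZeta (1 / 2 + t * Complex.I) *
        ∑ n : Fin N, a n * ((n : ℂ) + 1) ^ (-(1 / 2 + t * Complex.I))‖ ^ 2 / (1 / 4 + t ^ 2)) := by
  have key : ∀ {c : ℝ}, c < 28467 / 100000 →
      ∫⁻ t : ℝ, ENNReal.ofReal (‖1 - riemannZeta (1 / 2 + t * Complex.I) *
        ∑ n : Fin N, a n * ((n : ℂ) + 1) ^ (-(1 / 2 + t * Complex.I))‖ ^ 2 / (1 / 4 + t ^ 2)) ≤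
      ENNReal.ofReal (c / Real.log N) → False :=
    fun hc hw ↦ not_nb_halfDoublingTail_of_certificate_of_checks hCh hS hH h2 hc a hw h
  clear hCh hS h
  by_contra hlt
  push Not at hlt
  have hlog : 0 < Real.log N := Real.log_pos (by exact_mod_cast h2)
  set Iv : ℝ≥0∞ := ∫⁻ t : ℝ, ENNReal.ofReal (‖1 - riemannZeta (1 / 2 + t * Complex.I) *
        ∑ n : Fin N, a n * ((n : ℂ) + 1) ^ (-(1 / 2 + t * Complex.I))‖ ^ 2 / (1 / 4 + t ^ 2)) with hIv
  have hfin : Iv ≠ ⊤ := (hlt.trans_le le_top).ne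
  set c : ℝ := Iv.toReal * Real.log N with hc
  have hIc : Iv = ENNReal.ofReal (c / Real.log N) := by
    rw [hc, mul_div_cancel_right₀ _ hlog.ne', ENNReal.ofReal_toReal hfin]
  have hclt : c < 28467 / 100000 := by
    have h1 : Iv.toReal < 28467 / 100000 / Real.log N := by
      have := (ENNReal.toReal_lt_toReal hfin ENNReal.ofReal_ne_top).mpr hlt
      rwa [ENNReal.toReal_ofReal (by positivity)] at this
    rw [hc, ← lt_div_iff₀ hlog]
    exact h1
  exact key hclt hIc.le

end Summit.RiemannHypothesis.RiemannHypothesis.Theorems.Splittings.NbMertensZerosFloor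

end
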